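import Literature.Geometry.Kaehler.ComplexTorusLineBundleHodgeNumbers
import Literature.Geometry.Kaehler.ComplexTorusPicardPoincareProperties
import HarnessLib

/-!
# `h^q(L)` and `χ(L)` for classes `L ∈ Pic(X)` of a complex torus: Lange (2023) §1.6–§1.7 on the Picard group

Layer `Literature/Geometry/Kaehler`, namespace `Literature.Geometry.Kaehler.ComplexTorus`; lane `lit-hodgefound`
(Layer A2, seat `lit-hodgefound-skel-2`, generation 30), row **A2-103** of `run/shared/lean/pub/lit-hodgefound/SKELETON.md`.
FILE 2 of the interface of row A2-102. TWO DEFINITIONS WITH BODIES (`Pic.hodgeNumber`, `Pic.eulerChar`) and THEOREMS; no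
named fact.

Row A2-102 (`ComplexTorusLineBundleHodgeNumbers`) attached the numbers `h^q` and `χ` to Appell–Humbert data
`(H, χ) ∈ 𝒫(Λ)`. Lange states them for "`L ∈ Pic(X)`" [p0066 "Let `X` be a complex torus of dimension `g` and
`L = L(H, χ) ∈ Pic(X)`"; p0072 "**Corollary 1.7.2** For every `L ∈ Pic(X)`"; p0073 "`f : Y → X` […] and `L ∈ Pic(X)`. Then
`χ(f^*L) = deg f · χ(L)`"]; the tree HAS the group `Pic(X)` (row A2-40 `ComplexTorusPicardGroup`: `Pic Φ` = factors of
automorphy modulo coboundaries, the Appell–Humbert isomorphism `AHData.ahEquivPic : 𝒫(Λ) ≃* Pic(X)` of Thm. 1.3.3, the class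
map `Pic.nsForm : Pic(X) → NS(X)`, `Pic⁰(X) = picZero`), its translations `Pic.translate` (A2-41), inverse images
`Pic.pullback` (A2-42), `n_X^* = Pic.mulN` (A2-43) and exterior products `Pic.boxProd` (A2-47). This file transports A2-102
through `ahEquivPic`:

* **`Pic.hodgeNumber x q := h^q(L)`**, **`Pic.eulerChar x := χ(L)`** for `x = [L] ∈ Pic(X)` (`hodgeNumber_toPic`, `eulerChar_toPic`:
  on `[L(H, χ)]` they are the numbers of row A2-102);
* the statements of §1.6–§1.7 for classes, with `E = Pic.nsForm x = c₁(L)`, `g = dim_ℂ V`, `s = hermIndex E`,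
  `r = hermIndex (-E)`: Thm. 1.6.4 (`hodgeNumber_eq_zero_of_lt_or_lt`), Thm. 1.6.8 for non-degenerate `L`
  (`hodgeNumber_eq_ite_of_nondegenerate`), positive `L`, `𝒪_X`, (1.27) (`hodgeNumber_inv`), Thm. 1.7.1
  (`eulerChar_eq_of_nondegenerate`, `eulerChar_eq_zero_of_not_nondegenerate`), Thm. 1.7.3 (`riemannRoch`), Cor. 1.7.2
  (`polarizationDegree_eq_eulerChar_sq`), Cor. 1.7.6 (`eulerChar_pullback`), `χ(L^k) = k^g χ(L)`, `χ(n_X^*L) = n^{2g} χ(L)`;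
* **what only makes sense on `Pic(X)`**: `χ` depends only on the class in `NS(X)` (`eulerChar_eq_of_nsForm_eq`), is invariant
  under translations `t_x̄^*` (`eulerChar_translate`) and under `Pic⁰(X)`-twists (`eulerChar_mul_of_mem_picZero`); the same for
  all `h^q` when `L` is non-degenerate (`hodgeNumber_translate`, `hodgeNumber_mul_of_mem_picZero` — "`L ⊗ P ≅ t_x̄^*L`");
* `⊠`: `AHData.toPic_boxProd` (`[L(H₁,χ₁)] ⊠ [L(H₂,χ₂)] = [L(H₁ ⊞ H₂, χ₁ ⊠ χ₂)]`, Lemma 1.3.6 along the projections) and the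
  Künneth formula on classes (`hodgeNumber_boxProd`, `eulerChar_boxProd`).

The degenerate main case of Thm. 1.6.8 (hypothesis "`L|_{K(L)⁰}` trivial", a condition on the semicharacter) stays on
`𝒫(Λ)` (row A2-102 `AHData.hodgeNumber_eq_choose_mul_reducedPfaffian`), reachable through `ahEquivPic`.

## References

* [Lange2023AbelianVarietiesComplex] H. Lange, *Abelian Varieties over the Complex Numbers*, Springer (2023), §1.3.2 Thm. 1.3.3,
  §1.3.3 Lemma 1.3.6, Prop. 1.3.7, §1.4.2, §1.6.1 (p0062), §1.6.2 Thm. 1.6.4, (1.27), §1.6.3 Thm. 1.6.8, §1.6.4 Ex. (1),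
  §1.7 (p0071), Thm. 1.7.1, Cor. 1.7.2, Thm. 1.7.3, Cor. 1.7.6, §6.1.1 Lemma 6.1.3.
* [HuybrechtsCG2005] D. Huybrechts, *Complex Geometry* (2005), §2.6 Def. 2.6.24, §4.1 Cor. 4.1.16.
* [GortzWedhorn2023] U. Görtz, T. Wedhorn, *Algebraic Geometry II* (2023), Cor. 22.110 (Künneth formula).
-/

noncomputable section

open scoped ComplexConjugate
open Finset Module Complex

namespace Literature.Geometry.Kaehler

namespace ComplexTorus

/-! ## §1 `h^q` and `χ` on `Pic(X)` -/

section Defs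

variable {ι : Type*} [Fintype ι] [DecidableEq ι] {E : Type*} [NormedAddCommGroup E] [NormedSpace ℂ E]
  [FiniteDimensional ℂ E] {Φ : (ι → ℝ) ≃L[ℝ] E}

/-- **`h^q(L)` for a class `x = [L] ∈ Pic(X)`**: `dim_ℂ H^{0,q}_∂̄(X, L(H, χ))` for THE Appell–Humbert datum `(H, χ)` of `x`
(Thm. 1.3.3, `ahEquivPic.symm x`). [cite: Lange2023AbelianVarietiesComplex, §1.6.1 (p0062) and §1.3.2 Thm. 1.3.3] [cite: HuybrechtsCG2005, §2.6 Def. 2.6.24] -/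
def Pic.hodgeNumber (x : Pic Φ) (q : ℕ) : ℕ :=
  (AHData.ahEquivPic.symm x).hodgeNumber q

/-- **`χ(L) = Σ_q (-1)^q h^q(L)` for a class `x = [L] ∈ Pic(X)`.** [cite: Lange2023AbelianVarietiesComplex, §1.7 (p0071)] [cite: Lange2023AbelianVarietiesComplex, §1.3.2 Thm. 1.3.3] -/
def Pic.eulerChar (x : Pic Φ) : ℤ :=
  (AHData.ahEquivPic.symm x).eulerChar

/-- Unfolding of `Pic.hodgeNumber`. [cite: Lange2023AbelianVarietiesComplex, §1.6.1 (p0062)] -/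
theorem Pic.hodgeNumber_def (x : Pic Φ) (q : ℕ) : x.hodgeNumber q = (AHData.ahEquivPic.symm x).hodgeNumber q :=
  rfl

/-- Unfolding of `Pic.eulerChar`. [cite: Lange2023AbelianVarietiesComplex, §1.7 (p0071)] -/
theorem Pic.eulerChar_def (x : Pic Φ) : x.eulerChar = (AHData.ahEquivPic.symm x).eulerChar :=
  rfl

/-- The datum of `[L(H, χ)]` is `(H, χ)`. [cite: Lange2023AbelianVarietiesComplex, §1.3.2 Thm. 1.3.3] -/
theorem AHData.ahEquivPic_symm_toPic (p : AHData Φ) : AHData.ahEquivPic.symm (AHData.toPic p) = p := by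
  rw [← AHData.ahEquivPic_apply, MulEquiv.symm_apply_apply]

/-- **`h^q([L(H, χ)]) = h^q(L(H, χ))`** (row A2-102's number). [cite: Lange2023AbelianVarietiesComplex, §1.6.1 (p0062)] -/
@[simp] theorem Pic.hodgeNumber_toPic (p : AHData Φ) (q : ℕ) : (AHData.toPic p).hodgeNumber q = p.hodgeNumber q := by
  rw [Pic.hodgeNumber_def, AHData.ahEquivPic_symm_toPic]

/-- **`χ([L(H, χ)]) = χ(L(H, χ))`.** [cite: Lange2023AbelianVarietiesComplex, §1.7 (p0071)] -/
@[simp] theorem Pic.eulerChar_toPic (p : AHData Φ) : (AHData.toPic p).eulerChar = p.eulerChar := by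
  rw [Pic.eulerChar_def, AHData.ahEquivPic_symm_toPic]

/-- The form of the datum of `x` is `c₁(x) = Pic.nsForm x`. [cite: Lange2023AbelianVarietiesComplex, §1.3.2 Thm. 1.3.3] -/
theorem AHData.form_ahEquivPic_symm (x : Pic Φ) : (AHData.ahEquivPic.symm x).form = Pic.nsForm x := by
  obtain ⟨p, rfl⟩ := AHData.toPic_surjective x
  rw [AHData.ahEquivPic_symm_toPic, AHData.nsForm_toPic]

/-- **`χ(L) = Σ_{q=0}^{g} (-1)^q h^q(L)`**, `g = dim_ℂ V`. [cite: Lange2023AbelianVarietiesComplex, §1.7 (p0071)] -/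
theorem Pic.eulerChar_eq_sum (x : Pic Φ) :
    x.eulerChar = ∑ q ∈ Finset.range (Module.finrank ℂ E + 1), (-1 : ℤ) ^ q * (x.hodgeNumber q : ℤ) :=
  rfl

/-- **`h^q(L) = 0` for `q > g`.** [cite: Lange2023AbelianVarietiesComplex, §1.6.1 (1.23)] -/
theorem Pic.hodgeNumber_eq_zero_of_finrank_lt (x : Pic Φ) {q : ℕ} (hq : Module.finrank ℂ E < q) : x.hodgeNumber q = 0 :=
  (AHData.ahEquivPic.symm x).hodgeNumber_eq_zero_of_finrank_lt hq

/-- **`h^q(𝒪_X) = binom(g, q)`.** [cite: Lange2023AbelianVarietiesComplex, §1.6.4 Exercise (1)] -/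
theorem Pic.hodgeNumber_one (q : ℕ) : (1 : Pic Φ).hodgeNumber q = (Module.finrank ℂ E).choose q := by
  rw [Pic.hodgeNumber_def, map_one, AHData.hodgeNumber_one]

end Defs

/-! ## §2 The table of `h^q(L)` for `L ∈ Pic(X)` -/

section Table

variable {ι : Type*} [Fintype ι] [DecidableEq ι] {E : Type*} [NormedAddCommGroup E] [NormedSpace ℂ E]
  [FiniteDimensional ℂ E] {Φ : (ι → ℝ) ≃L[ℝ] E}

/-- **THEOREM 1.6.4 (Vanishing Theorem) on `Pic(X)`: `h^q(L) = 0` for `q > g - r` and for `q < s`**, `E = c₁(L) = Im H`,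
`r = hermIndex (-E)`, `s = hermIndex E` the numbers of positive / negative eigenvalues of `H` (row A2-100).
[cite: Lange2023AbelianVarietiesComplex, §1.6.2 Thm. 1.6.4] -/
theorem Pic.hodgeNumber_eq_zero_of_lt_or_lt (x : Pic Φ) {q : ℕ}
    (hq : Module.finrank ℂ E - hermIndex (-Pic.nsForm x) < q ∨ q < hermIndex (Pic.nsForm x)) : x.hodgeNumber q = 0 := by
  rw [← AHData.form_ahEquivPic_symm] at hq
  exact (AHData.ahEquivPic.symm x).hodgeNumber_eq_zero_of_lt_or_lt hq

/-- **THEOREM 1.6.8 for NON-DEGENERATE `L ∈ Pic(X)` (Mumford's index theorem): `h^q(L) = d₁⋯d_g` if `q = s`, else `0`.**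
[cite: Lange2023AbelianVarietiesComplex, §1.6.3 Thm. 1.6.8] -/
theorem Pic.hodgeNumber_eq_ite_of_nondegenerate (x : Pic Φ) (hnd : ∀ v : E, v ≠ 0 → ∃ u : E, Pic.nsForm x ![v, u] ≠ 0)
    {g : ℕ} {d : Fin g → ℕ} (hd : IsPolarizationType Φ (Pic.nsForm x) d) (q : ℕ) :
    x.hodgeNumber q = if q = hermIndex (Pic.nsForm x) then ∏ i, d i else 0 := by
  rw [← AHData.form_ahEquivPic_symm] at hnd hd ⊢
  exact (AHData.ahEquivPic.symm x).hodgeNumber_eq_ite_of_nondegenerate hnd hd q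

/-- **`h^q(L) = 0` for `q ≥ 1` and `L ∈ Pic(X)` positive.** [cite: Lange2023AbelianVarietiesComplex, §1.6.2 Thm. 1.6.4] -/
theorem Pic.hodgeNumber_eq_zero_of_isRiemannForm (x : Pic Φ) (hpos : IsRiemannForm Φ (Pic.nsForm x)) {q : ℕ} (hq : 1 ≤ q) :
    x.hodgeNumber q = 0 := by
  rw [← AHData.form_ahEquivPic_symm] at hpos
  exact (AHData.ahEquivPic.symm x).hodgeNumber_eq_zero_of_isRiemannForm hpos hq

/-- **`h⁰(L) = d₁⋯d_g` for a positive `L ∈ Pic(X)` of type `(d₁, …, d_g)`** (Thm. 1.5.9 / Riemann–Roch).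
[cite: Lange2023AbelianVarietiesComplex, §1.5.3 Thm. 1.5.9] [cite: Lange2023AbelianVarietiesComplex, §1.6.3 Thm. 1.6.8] -/
theorem Pic.hodgeNumber_zero_eq_prod_of_isRiemannForm (x : Pic Φ) (hpos : IsRiemannForm Φ (Pic.nsForm x)) {g : ℕ}
    {d : Fin g → ℕ} (hd : IsPolarizationType Φ (Pic.nsForm x) d) : x.hodgeNumber 0 = ∏ i, d i := by
  rw [← AHData.form_ahEquivPic_symm] at hpos hd
  exact (AHData.ahEquivPic.symm x).hodgeNumber_zero_eq_prod_of_isRiemannForm hpos hd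

/-- **(1.27) on `Pic(X)`: `h^q(L⁻¹) = h^{g-q}(L)`**, `q ≤ g`. [cite: Lange2023AbelianVarietiesComplex, §1.6.2 (1.27), p0067] [cite: HuybrechtsCG2005, §4.1 Cor. 4.1.16] -/
theorem Pic.hodgeNumber_inv (x : Pic Φ) {q : ℕ} (hq : q ≤ Module.finrank ℂ E) :
    x⁻¹.hodgeNumber q = x.hodgeNumber (Module.finrank ℂ E - q) := by
  rw [Pic.hodgeNumber_def, map_inv, AHData.hodgeNumber_inv _ hq, ← Pic.hodgeNumber_def]

/-- **For non-degenerate classes `h^q` depends only on `c₁`**: `c₁(x) = c₁(y)` non-degenerate ⇒ `h^q(x) = h^q(y)`.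
[cite: Lange2023AbelianVarietiesComplex, §1.6.3 Thm. 1.6.8] -/
theorem Pic.hodgeNumber_eq_of_nsForm_eq_of_nondegenerate {x y : Pic Φ} (h : Pic.nsForm x = Pic.nsForm y)
    (hnd : ∀ v : E, v ≠ 0 → ∃ u : E, Pic.nsForm x ![v, u] ≠ 0) (q : ℕ) : x.hodgeNumber q = y.hodgeNumber q := by
  rw [← AHData.form_ahEquivPic_symm] at hnd h
  rw [← AHData.form_ahEquivPic_symm] at h
  exact AHData.hodgeNumber_eq_of_form_eq_of_nondegenerate h hnd q

/-- **`h^q(t_x̄^*L) = h^q(L)` for non-degenerate `L`** (translations do not change `c₁`, §1.4.2).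
[cite: Lange2023AbelianVarietiesComplex, §1.4.2 (first sentence) and §1.6.3 Thm. 1.6.8] -/
theorem Pic.hodgeNumber_translate (t : ComplexTorus Φ) (x : Pic Φ)
    (hnd : ∀ v : E, v ≠ 0 → ∃ u : E, Pic.nsForm x ![v, u] ≠ 0) (q : ℕ) :
    (Pic.translate t x).hodgeNumber q = x.hodgeNumber q :=
  Pic.hodgeNumber_eq_of_nsForm_eq_of_nondegenerate (Pic.nsForm_translate t x)
    (by rw [Pic.nsForm_translate]; exact hnd) q

/-- **`h^q(L ⊗ P) = h^q(L)` for non-degenerate `L` and `P ∈ Pic⁰(X)`** ("`L ⊗ P ≅ t_x̄^*L` for some `x̄`", `K(L)` finite).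
[cite: Lange2023AbelianVarietiesComplex, §1.6.3 Thm. 1.6.8] [cite: Lange2023AbelianVarietiesComplex, §1.3.1 p. 28 (Pic⁰)] -/
theorem Pic.hodgeNumber_mul_of_mem_picZero (x : Pic Φ) {y : Pic Φ} (hy : y ∈ picZero Φ)
    (hnd : ∀ v : E, v ≠ 0 → ∃ u : E, Pic.nsForm x ![v, u] ≠ 0) (q : ℕ) : (x * y).hodgeNumber q = x.hodgeNumber q := by
  have h : Pic.nsForm (x * y) = Pic.nsForm x := by rw [Pic.nsForm_mul, (mem_picZero_iff Φ y).1 hy, add_zero]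
  exact Pic.hodgeNumber_eq_of_nsForm_eq_of_nondegenerate h (by rw [h]; exact hnd) q

end Table

/-! ## §3 `χ(L)` for `L ∈ Pic(X)` -/

section EulerChar

variable {ι : Type*} [Fintype ι] [DecidableEq ι] {E : Type*} [NormedAddCommGroup E] [NormedSpace ℂ E]
  [FiniteDimensional ℂ E] {Φ : (ι → ℝ) ≃L[ℝ] E}

/-- **`χ(L)` depends only on the class of `L` in `NS(X)`** (Thm. 1.7.1: `χ(L) = (-1)^s Pf(E)`).
[cite: Lange2023AbelianVarietiesComplex, §1.7.1 Thm. 1.7.1] -/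
theorem Pic.eulerChar_eq_of_nsForm_eq {x y : Pic Φ} (h : Pic.nsForm x = Pic.nsForm y) : x.eulerChar = y.eulerChar := by
  rw [← AHData.form_ahEquivPic_symm, ← AHData.form_ahEquivPic_symm] at h
  exact AHData.eulerChar_eq_of_form_eq h

/-- **`χ(t_x̄^*L) = χ(L)`.** [cite: Lange2023AbelianVarietiesComplex, §1.7.1 Thm. 1.7.1] [cite: Lange2023AbelianVarietiesComplex, §1.4.2 (first sentence)] -/
theorem Pic.eulerChar_translate (t : ComplexTorus Φ) (x : Pic Φ) : (Pic.translate t x).eulerChar = x.eulerChar :=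
  Pic.eulerChar_eq_of_nsForm_eq (Pic.nsForm_translate t x)

/-- **`χ(L ⊗ P) = χ(L)` for `P ∈ Pic⁰(X)`.** [cite: Lange2023AbelianVarietiesComplex, §1.7.1 Thm. 1.7.1] [cite: Lange2023AbelianVarietiesComplex, §1.3.1 p. 28 (Pic⁰)] -/
theorem Pic.eulerChar_mul_of_mem_picZero (x : Pic Φ) {y : Pic Φ} (hy : y ∈ picZero Φ) : (x * y).eulerChar = x.eulerChar :=
  Pic.eulerChar_eq_of_nsForm_eq (by rw [Pic.nsForm_mul, (mem_picZero_iff Φ y).1 hy, add_zero])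

/-- **`χ(P) = χ(𝒪_X)` for `P ∈ Pic⁰(X)`** (hence `0` for `g ≥ 1`). [cite: Lange2023AbelianVarietiesComplex, §1.7.1 Thm. 1.7.1] -/
theorem Pic.eulerChar_of_mem_picZero {y : Pic Φ} (hy : y ∈ picZero Φ) : y.eulerChar = (1 : Pic Φ).eulerChar := by
  rw [← one_mul y]
  exact Pic.eulerChar_mul_of_mem_picZero 1 hy

/-- **THEOREM 1.7.1 on `Pic(X)`: `χ(L) = (-1)^s d₁⋯d_g`** for `L` non-degenerate of type `(d₁, …, d_g)`, `s = hermIndex c₁(L)`.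
[cite: Lange2023AbelianVarietiesComplex, §1.7.1 Thm. 1.7.1] -/
theorem Pic.eulerChar_eq_of_nondegenerate (x : Pic Φ) (hnd : ∀ v : E, v ≠ 0 → ∃ u : E, Pic.nsForm x ![v, u] ≠ 0)
    {g : ℕ} {d : Fin g → ℕ} (hd : IsPolarizationType Φ (Pic.nsForm x) d) :
    x.eulerChar = (-1) ^ hermIndex (Pic.nsForm x) * ∏ i, (d i : ℤ) := by
  rw [← AHData.form_ahEquivPic_symm] at hnd hd ⊢
  exact (AHData.ahEquivPic.symm x).eulerChar_eq_of_nondegenerate hnd hd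

/-- **THEOREM 1.7.1, "for degenerate `L` we have `χ(L) = 0`", on `Pic(X)`.** [cite: Lange2023AbelianVarietiesComplex, §1.7.1 Thm. 1.7.1] -/
theorem Pic.eulerChar_eq_zero_of_not_nondegenerate (x : Pic Φ)
    (hdeg : ¬ ∀ v : E, v ≠ 0 → ∃ u : E, Pic.nsForm x ![v, u] ≠ 0) : x.eulerChar = 0 := by
  rw [← AHData.form_ahEquivPic_symm] at hdeg
  exact (AHData.ahEquivPic.symm x).eulerChar_eq_zero_of_not_nondegenerate hdeg

/-- **`χ(L) = d₁⋯d_g` for a positive `L ∈ Pic(X)`** ("`h⁰(L) = χ(L) = d₁ · … · d_g`", proof of Prop. 2.1.11).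
[cite: Lange2023AbelianVarietiesComplex, §1.7.1 Thm. 1.7.1] [cite: Lange2023AbelianVarietiesComplex, §2.1.3 Prop. 2.1.11 (proof)] -/
theorem Pic.eulerChar_eq_prod_of_isRiemannForm (x : Pic Φ) (hpos : IsRiemannForm Φ (Pic.nsForm x)) {g : ℕ} {d : Fin g → ℕ}
    (hd : IsPolarizationType Φ (Pic.nsForm x) d) : x.eulerChar = ∏ i, (d i : ℤ) := by
  rw [← AHData.form_ahEquivPic_symm] at hpos hd
  exact (AHData.ahEquivPic.symm x).eulerChar_eq_prod_of_isRiemannForm hpos hd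

/-- **THEOREM 1.7.3 (geometric Riemann–Roch) on `Pic(X)`: `g! · χ(L) = (L^g) = ∫_X c₁(L)^{∧g}`**, `c₁(L) = -E` in the tree's
normalisation. [cite: Lange2023AbelianVarietiesComplex, §1.7.2 Thm. 1.7.3] -/
theorem Pic.riemannRoch (x : Pic Φ) (eι : Fin (2 * Module.finrank ℂ E) ≃ ι) :
    ((Module.finrank ℂ E).factorial : ℂ) * (x.eulerChar : ℂ) =
      torusIntegral Φ eι (wedgePow (ofRealForm (-Pic.nsForm x)) (Module.finrank ℂ E)) := by
  rw [← AHData.form_ahEquivPic_symm]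
  exact (AHData.ahEquivPic.symm x).riemannRoch eι

/-- **COROLLARY 1.7.2 on `Pic(X)`: `deg φ_L = χ(L)²` for every `L ∈ Pic(X)`.** [cite: Lange2023AbelianVarietiesComplex, §1.7.1 Cor. 1.7.2] -/
theorem Pic.polarizationDegree_eq_eulerChar_sq (x : Pic Φ) :
    polarizationDegree Φ (Pic.nsForm x) = ((x.eulerChar : ℤ) : ℝ) ^ 2 := by
  rw [← AHData.form_ahEquivPic_symm]
  exact (AHData.ahEquivPic.symm x).polarizationDegree_eq_eulerChar_sq

/-- **`χ(L^k) = k^g · χ(L)`**, `k ∈ ℤ`. [cite: Lange2023AbelianVarietiesComplex, §1.7.2 Thm. 1.7.3] -/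
theorem Pic.eulerChar_zpow (x : Pic Φ) (k : ℤ) : (x ^ k).eulerChar = k ^ Module.finrank ℂ E * x.eulerChar := by
  rw [Pic.eulerChar_def, map_zpow, AHData.eulerChar_zpow, ← Pic.eulerChar_def]

/-- **`χ(Lⁿ) = n^g · χ(L)`**, `n ∈ ℕ`. [cite: Lange2023AbelianVarietiesComplex, §1.7.2 Thm. 1.7.3] -/
theorem Pic.eulerChar_pow (x : Pic Φ) (n : ℕ) : (x ^ n).eulerChar = (n : ℤ) ^ Module.finrank ℂ E * x.eulerChar := by
  rw [Pic.eulerChar_def, map_pow, AHData.eulerChar_pow, ← Pic.eulerChar_def]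

/-- **`χ(L⁻¹) = (-1)^g · χ(L)`.** [cite: Lange2023AbelianVarietiesComplex, §1.7.2 Thm. 1.7.3] -/
theorem Pic.eulerChar_inv (x : Pic Φ) : x⁻¹.eulerChar = (-1) ^ Module.finrank ℂ E * x.eulerChar := by
  rw [Pic.eulerChar_def, map_inv, AHData.eulerChar_inv, ← Pic.eulerChar_def]

/-- **`χ(n_X^* L) = n^{2g} · χ(L)` for every `L ∈ Pic(X)`**, `n ∈ ℤ` (Cor. 1.7.6 for `n_X`; Prop. 1.3.7).
[cite: Lange2023AbelianVarietiesComplex, §1.7.2 Cor. 1.7.6] [cite: Lange2023AbelianVarietiesComplex, §1.3.3 Prop. 1.3.7] -/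
theorem Pic.eulerChar_mulN (n : ℤ) (x : Pic Φ) : (Pic.mulN Φ n x).eulerChar = n ^ (2 * Module.finrank ℂ E) * x.eulerChar := by
  obtain ⟨p, rfl⟩ := AHData.toPic_surjective x
  rw [AHData.toPic_mulN, Pic.eulerChar_toPic, Pic.eulerChar_toPic, AHData.eulerChar_mulN]

/-- **`χ((-1)_X^* L) = χ(L)` for every class** (`n = -1`: `deg (-1)_X = (-1)^{2g} = 1`; `(-1)_X` is an automorphism).
[cite: Lange2023AbelianVarietiesComplex, §1.7.2 Cor. 1.7.6] -/
theorem Pic.eulerChar_mulN_neg_one (x : Pic Φ) : (Pic.mulN Φ (-1) x).eulerChar = x.eulerChar := by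
  rw [Pic.eulerChar_mulN, pow_mul, neg_one_sq, one_pow, one_mul]

/-- **`χ(𝒪_X) = 0` for `g ≥ 1`.** [cite: Lange2023AbelianVarietiesComplex, §1.7.1 Thm. 1.7.1] -/
theorem Pic.eulerChar_one_eq_zero (hE : 0 < Module.finrank ℂ E) : (1 : Pic Φ).eulerChar = 0 := by
  rw [Pic.eulerChar_def, map_one, AHData.eulerChar_one_eq_zero hE]

end EulerChar

section Pullback

variable {ι : Type*} [Fintype ι] [DecidableEq ι]
  {E E' : Type*} [NormedAddCommGroup E] [NormedSpace ℂ E] [NormedAddCommGroup E'] [NormedSpace ℂ E']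
  [FiniteDimensional ℂ E] [FiniteDimensional ℂ E']
  (Φ : (ι → ℝ) ≃L[ℝ] E) (Φ' : (ι → ℝ) ≃L[ℝ] E') {A : Matrix ι ι ℤ} {F : E →L[ℂ] E'}

/-- **COROLLARY 1.7.6 on `Pic`: `χ(f^*L) = deg f · χ(L)` for every `L ∈ Pic(X′)`**, `f = mapMatrix Φ Φ′ A : X → X′` with
complex-linear analytic representation, `deg f = #Ker f` (`0` for a non-isogeny), `f^* = Pic.pullback` (row A2-42).
[cite: Lange2023AbelianVarietiesComplex, §1.7.2 Cor. 1.7.6] [cite: Lange2023AbelianVarietiesComplex, §1.1.2 Prop. 1.1.13] -/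
theorem Pic.eulerChar_pullback (hF : ∀ x, Φ' ((A.map (Int.cast : ℤ → ℝ)).mulVec x) = F (Φ x)) (x' : Pic Φ') :
    (Pic.pullback Φ Φ' hF x').eulerChar = (Nat.card (mapMatrixHom Φ Φ' A).ker : ℤ) * x'.eulerChar := by
  obtain ⟨p', rfl⟩ := AHData.toPic_surjective x'
  rw [AHData.toPic_pullback, Pic.eulerChar_toPic, Pic.eulerChar_toPic, AHData.eulerChar_pullback]

end Pullback

/-! ## §4 `⊠` on classes and the Künneth formula -/

section BoxProd

variable {ι₁ ι₂ : Type*} [Fintype ι₁] [Fintype ι₂] [DecidableEq ι₁] [DecidableEq ι₂] {E₁ E₂ : Type*}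
  [NormedAddCommGroup E₁] [NormedSpace ℂ E₁] [NormedAddCommGroup E₂] [NormedSpace ℂ E₂]
  [FiniteDimensional ℂ E₁] [FiniteDimensional ℂ E₂] (Φ₁ : (ι₁ → ℝ) ≃L[ℝ] E₁) (Φ₂ : (ι₂ → ℝ) ≃L[ℝ] E₂)

omit [FiniteDimensional ℂ E₁] [FiniteDimensional ℂ E₂] in
/-- **`p₁^*(H₁, χ₁) · p₂^*(H₂, χ₂) = (H₁ ⊞ H₂, χ₁ ⊠ χ₂)` in `𝒫(Λ₁ ⊕ Λ₂)`** (Lemma 1.3.6 along the two projections).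
[cite: Lange2023AbelianVarietiesComplex, §1.3.3 Lemma 1.3.6] [cite: Lange2023AbelianVarietiesComplex, §2.4.4 Cor. 2.4.24] -/
theorem AHData.pullback_fst_mul_pullback_snd (p₁ : AHData Φ₁) (p₂ : AHData Φ₂) :
    AHData.pullback (prodPeriod Φ₁ Φ₂) Φ₁ (apply_mulVec_fromCols_one_zero Φ₁ Φ₂) p₁ *
        AHData.pullback (prodPeriod Φ₁ Φ₂) Φ₂ (apply_mulVec_fromCols_zero_one Φ₁ Φ₂) p₂ =
      p₁.boxProd p₂ := by
  refine AHData.ext ?_ ?_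
  · rw [AHData.mul_form, AHData.pullback_form, AHData.pullback_form, AHData.boxProd_form]
    ext m
    have hm : m = ![m 0, m 1] := by
      funext i
      fin_cases i <;> rfl
    rw [hm, ContinuousAlternatingMap.add_apply, pullbackForm_apply, pullbackForm_apply, prodForm_apply]
    rfl
  · rw [AHData.mul_char, AHData.boxProd_char]
    funext n
    rw [Pi.mul_apply, AHData.pullback_char, AHData.pullback_char, Matrix.fromCols_mulVec, Matrix.fromCols_mulVec,
      Matrix.one_mulVec, Matrix.zero_mulVec, Matrix.zero_mulVec, Matrix.one_mulVec, add_zero, zero_add]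
    rfl

omit [FiniteDimensional ℂ E₁] [FiniteDimensional ℂ E₂] in
/-- **`[L(H₁, χ₁)] ⊠ [L(H₂, χ₂)] = [L(H₁ ⊞ H₂, χ₁ ⊠ χ₂)]` in `Pic(X₁ × X₂)`** (row A2-47's `Pic.boxProd` on Appell–Humbert classes).
[cite: Lange2023AbelianVarietiesComplex, §6.1.1 Lemma 6.1.3] [cite: Lange2023AbelianVarietiesComplex, §1.3.3 Lemma 1.3.6] -/
theorem AHData.toPic_boxProd (p₁ : AHData Φ₁) (p₂ : AHData Φ₂) :
    AHData.toPic (p₁.boxProd p₂) = Pic.boxProd Φ₁ Φ₂ (AHData.toPic p₁) (AHData.toPic p₂) := by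
  rw [Pic.boxProd_def, AHData.toPic_pullback, AHData.toPic_pullback, ← map_mul, AHData.pullback_fst_mul_pullback_snd]

/-- **THE KÜNNETH FORMULA on classes: `h^n(a ⊠ b) = Σ_{p+q=n} h^p(a) · h^q(b)`** for `a ∈ Pic(X₁)`, `b ∈ Pic(X₂)`.
[cite: GortzWedhorn2023, Cor. 22.110 (Künneth formula)] [cite: Lange2023AbelianVarietiesComplex, §2.2.1 p0093] -/
theorem Pic.hodgeNumber_boxProd (a : Pic Φ₁) (b : Pic Φ₂) (n : ℕ) :
    (Pic.boxProd Φ₁ Φ₂ a b).hodgeNumber n = ∑ pq ∈ antidiagonal n, a.hodgeNumber pq.1 * b.hodgeNumber pq.2 := by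
  obtain ⟨p₁, rfl⟩ := AHData.toPic_surjective a
  obtain ⟨p₂, rfl⟩ := AHData.toPic_surjective b
  rw [← AHData.toPic_boxProd, Pic.hodgeNumber_toPic, AHData.hodgeNumber_boxProd]
  simp only [Pic.hodgeNumber_toPic]

/-- **`χ(a ⊠ b) = χ(a) · χ(b)`.** [cite: GortzWedhorn2023, Cor. 22.110 (Künneth formula)] [cite: Lange2023AbelianVarietiesComplex, §2.2.1 p0093] -/
theorem Pic.eulerChar_boxProd (a : Pic Φ₁) (b : Pic Φ₂) :
    (Pic.boxProd Φ₁ Φ₂ a b).eulerChar = a.eulerChar * b.eulerChar := by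
  obtain ⟨p₁, rfl⟩ := AHData.toPic_surjective a
  obtain ⟨p₂, rfl⟩ := AHData.toPic_surjective b
  rw [← AHData.toPic_boxProd, Pic.eulerChar_toPic, Pic.eulerChar_toPic, Pic.eulerChar_toPic, AHData.eulerChar_boxProd]

/-- **`h⁰(a ⊠ b) = h⁰(a) · h⁰(b)`.** [cite: Lange2023AbelianVarietiesComplex, §2.2.1 p0093 L1–L4] -/
theorem Pic.hodgeNumber_zero_boxProd (a : Pic Φ₁) (b : Pic Φ₂) :
    (Pic.boxProd Φ₁ Φ₂ a b).hodgeNumber 0 = a.hodgeNumber 0 * b.hodgeNumber 0 := by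
  rw [Pic.hodgeNumber_boxProd, Nat.antidiagonal_zero, Finset.sum_singleton]

end BoxProd

end ComplexTorus

end Literature.Geometry.Kaehler
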